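import Summits.CriticalPhenomena.SAWScalingLimit.Theorems.SAWTotalPositivityBoundaryTP2StripCertW4Base
import Summits.CriticalPhenomena.SAWScalingLimit.Theorems.SAWTotalPositivityBoundaryTP2StripCertW4Direct
import HarnessLib

/-!
# Crux `BoundaryTP2` (stmt-CriticalPhenomena-7115), line `Sketch`: `StripCert` part 7 — the six mixed TP₂ forms of
the width-4 strips are non-negative for EVERY length (tail `n ≥ 7` by the certified boxes and rates, `n ≤ 6` by
the direct kernel checks)

Abstract over four real vector trajectories `U⁺, W⁺` (even data `TeData`, initial `ue0`, `we0`) and `U⁻, W⁻`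
(odd data `ToData`, initial `uo0`, `wo0`) — instantiated with the strip kernels in part 8 — and the two
identifications `W± n 0 = U± n 1` (the symmetry `K(1,0) = K(0,1)` of the kernel matrix), we prove for all `n`
and `x ∈ [1/3, 5/13]`, with `A± = U± n 0`, `B± = U± n 1`, `E± = W± n 1`:
`(A⁺+A⁻)(E⁺+E⁻) ≥ (B⁺+B⁻)²`, `(A⁺+A⁻)(E⁺-E⁻) ≥ (B⁺+B⁻)(B⁺-B⁻)`, `(A⁺+A⁻)(B⁺-B⁻) ≥ (B⁺+B⁻)(A⁺-A⁻)`,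
`(B⁺+B⁻)(E⁺-E⁻) ≥ (B⁺-B⁻)(E⁺+E⁻)`, `(B⁺+B⁻)(B⁺-B⁻) ≥ (A⁺-A⁻)(E⁺+E⁻)`, `(B⁺-B⁻)² ≥ (A⁺-A⁻)(E⁺-E⁻)`
— i.e. `4(ae-b²), 4(af-bc), 4(ac-bd), 4(bf-ce), 4(bc-de), 4(c²-df) ≥ 0` for the kernel letters.
TAIL (`n ≥ 7`): the four sector trajectories and the even second compound `U⁺ ∧ W⁺` live in their certified
invariant tail boxes (parts 4–5), `B⁻ ≤ (3/100) B⁺` and `4 det⁺ ≤ B⁺B⁻` propagate from `n = 7` by the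
certified rates (`Um ≤ Sp`, `10⁴ Rp ≤ Sp Sm`), and each form is a positive combination of box facts.
HEAD (`n ≤ 6`): part 6. [folklore]
-/

namespace Summit.CriticalPhenomena.SAWScalingLimit.Theorems.BoundaryTP2.StripCert

open Summit.CriticalPhenomena.SAWScalingLimit.Theorems.BoundaryTP2.Negative.Cert

/-! ## §14 Generic consequences of the certificates -/

/-- Left end of the enclosure in the checker's format. [folklore] -/
theorem s4t_h1 {x : ℝ} (hx1 : 1 / 3 ≤ x) : ((13 : ℤ) : ℝ) / (39 : ℕ) ≤ x := by push_cast; linarith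

/-- Right end of the enclosure in the checker's format. [folklore] -/
theorem s4t_h2 {x : ℝ} (hx2 : x ≤ 5 / 13) : x ≤ (((13 : ℤ) : ℝ) + (2 : ℤ)) / (39 : ℕ) := by push_cast; linarith

/-- Number of index pairs below `6`. [folklore] -/
theorem pairs6_length : (pairs 6).length = 15 := by decide

/-- The first index pair. [folklore] -/
theorem pairs6_head : (pairs 6).getD 0 (0, 0) = (0, 1) := by decide

/-- A trajectory of `TeData` from `v₀` that is certified in the even tail box at `7` stays there. [folklore] -/
theorem even_tail_box {x : ℝ} (hx1 : 1 / 3 ≤ x) (hx2 : x ≤ 5 / 13) {v₀ : List (List ℤ)} (hb : boxMemCheck (iterMV TeData 6 7 v₀) 6 EBL EBH 10000 13 2 39 1 = true)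
    {U : ℕ → ℕ → ℝ} (h0 : ∀ i, i < 6 → U 0 i = evV v₀ x i)
    (hrec : ∀ t i, i < 6 → U (t + 1) i = mulTV TeData 6 x (U t) i) :
    ∀ t, 7 ≤ t → InBox EBL EBH 10000 6 (U t) := by
  have hbase : InBox EBL EBH 10000 6 (U 7) :=
    (inBox_evV_of_boxMemCheck hb (by norm_num) (by norm_num) (by norm_num) (s4t_h1 hx1) (s4t_h2 hx2)).congr
      (traj_eq_evV_iterMV TeData 6 x v₀ h0 hrec 7 0 (by norm_num))
      (fun i hi => traj_eq_evV_iterMV TeData 6 x v₀ h0 hrec 7 i hi)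
  exact inBox_traj cert_even_step (by norm_num) (by norm_num) (by norm_num) (by norm_num) (by norm_num)
    (s4t_h1 hx1) (s4t_h2 hx2) hrec hbase

/-- Same for the odd data. [folklore] -/
theorem odd_tail_box {x : ℝ} (hx1 : 1 / 3 ≤ x) (hx2 : x ≤ 5 / 13) {v₀ : List (List ℤ)} (hb : boxMemCheck (iterMV ToData 6 7 v₀) 6 OBL OBH 10000 13 2 39 1 = true)
    {U : ℕ → ℕ → ℝ} (h0 : ∀ i, i < 6 → U 0 i = evV v₀ x i)
    (hrec : ∀ t i, i < 6 → U (t + 1) i = mulTV ToData 6 x (U t) i) :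
    ∀ t, 7 ≤ t → InBox OBL OBH 10000 6 (U t) := by
  have hbase : InBox OBL OBH 10000 6 (U 7) :=
    (inBox_evV_of_boxMemCheck hb (by norm_num) (by norm_num) (by norm_num) (s4t_h1 hx1) (s4t_h2 hx2)).congr
      (traj_eq_evV_iterMV ToData 6 x v₀ h0 hrec 7 0 (by norm_num))
      (fun i hi => traj_eq_evV_iterMV ToData 6 x v₀ h0 hrec 7 i hi)
  exact inBox_traj cert_odd_step (by norm_num) (by norm_num) (by norm_num) (by norm_num) (by norm_num)
    (s4t_h1 hx1) (s4t_h2 hx2) hrec hbase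

/-- The even second compound `U⁺ ∧ W⁺` stays in its tail box. [folklore] -/
theorem L2_tail_box {x : ℝ} (hx1 : 1 / 3 ≤ x) (hx2 : x ≤ 5 / 13) {U W : ℕ → ℕ → ℝ} (hU0 : ∀ i, i < 6 → U 0 i = evV ue0 x i) (hW0 : ∀ i, i < 6 → W 0 i = evV we0 x i)
    (hU : ∀ t i, i < 6 → U (t + 1) i = mulTV TeData 6 x (U t) i)
    (hW : ∀ t i, i < 6 → W (t + 1) i = mulTV TeData 6 x (W t) i) :
    ∀ t, 7 ≤ t → InBox L2L L2H 10000 15 (wedgeR 6 (U t) (W t)) := by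
  have hbase := inBox_wedge_of_baseWedgeCheck cert_L2_base (by norm_num) (by norm_num) (by norm_num)
    (s4t_h1 hx1) (s4t_h2 hx2) hU0 hW0 hU hW (by rw [pairs6_length]; norm_num)
  rw [pairs6_length] at hbase
  have hrec : ∀ t p, p < 15 → wedgeR 6 (U (t + 1)) (W (t + 1)) p =
      mulTV (lambda2 TeData 6) 15 x (wedgeR 6 (U t) (W t)) p := by
    intro t p hp
    have := wedge_traj TeData 6 x hU hW t p (by rw [pairs6_length]; exact hp)
    rwa [pairs6_length] at this
  exact inBox_traj (z := fun t => wedgeR 6 (U t) (W t)) cert_L2_step (by norm_num) (by norm_num) (by norm_num)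
    (by norm_num) (by norm_num) (s4t_h1 hx1) (s4t_h2 hx2) hrec hbase

/-- The certified rates as real inequalities inside the boxes. [folklore] -/
theorem rates {x : ℝ} (hx1 : 1 / 3 ≤ x) (hx2 : x ≤ 5 / 13) :
    (∀ z : ℕ → ℝ, InBox EBL EBH 10000 6 z → evZ Sp x * z 1 ≤ 10000 * mulTV TeData 6 x z 1) ∧
    (∀ z : ℕ → ℝ, InBox OBL OBH 10000 6 z → evZ Sm x * z 1 ≤ 10000 * mulTV ToData 6 x z 1) ∧
    (∀ z : ℕ → ℝ, InBox OBL OBH 10000 6 z → 10000 * mulTV ToData 6 x z 1 ≤ evZ Um x * z 1) ∧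
    (∀ z : ℕ → ℝ, InBox L2L L2H 10000 15 z →
      10000 * mulTV (lambda2 TeData 6) 15 x z 0 ≤ evZ Rp x * z 0) := by
  refine ⟨fun z hz => ?_, fun z hz => ?_, fun z hz => ?_, fun z hz => ?_⟩
  · have := dotV_nonneg_of_consCheck (by norm_num) (by norm_num) (by norm_num) cert_rate_Sp
      (by simp [selfLoRateCons]) (s4t_h1 hx1) (s4t_h2 hx2) hz (by norm_num)
    rw [dotV_selfLoRateCons TeData (by norm_num : 1 < 6)] at this; push_cast at this; linarith
  · have := dotV_nonneg_of_consCheck (by norm_num) (by norm_num) (by norm_num) cert_rate_Sm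
      (by simp [selfLoRateCons]) (s4t_h1 hx1) (s4t_h2 hx2) hz (by norm_num)
    rw [dotV_selfLoRateCons ToData (by norm_num : 1 < 6)] at this; push_cast at this; linarith
  · have := dotV_nonneg_of_consCheck (by norm_num) (by norm_num) (by norm_num) cert_rate_Um
      (by simp [selfUpRateCons]) (s4t_h1 hx1) (s4t_h2 hx2) hz (by norm_num)
    rw [dotV_selfUpRateCons ToData (by norm_num : 1 < 6)] at this; push_cast at this; linarith
  · have := dotV_nonneg_of_consCheck (by norm_num) (by norm_num) (by norm_num) cert_rate_Rp
      (by simp [upRateCons]) (s4t_h1 hx1) (s4t_h2 hx2) hz (by norm_num)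
    rw [dotV_upRateCons _ (by norm_num : 0 < 15)] at this; push_cast at this; linarith

/-- The certified polynomial facts on the enclosure. [folklore] -/
theorem polyFacts {x : ℝ} (hx1 : 1 / 3 ≤ x) (hx2 : x ≤ 5 / 13) :
    evZ Um x ≤ evZ Sp x ∧ 10000 * evZ Rp x ≤ evZ Sp x * evZ Sm x ∧ 0 ≤ evZ Sp x ∧ 0 ≤ evZ Sm x ∧
      0 ≤ evZ Um x ∧ 0 ≤ evZ Rp x := by
  have h1 := evZ_nonneg_on_enclosure (by norm_num) cert_cmp_US hx1 hx2
  have h2 := evZ_nonneg_on_enclosure (by norm_num) cert_cmp_RSS hx1 hx2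
  rw [evZ_addZ, evZ_smulZ] at h1
  rw [evZ_addZ, evZ_mulZ, evZ_smulZ] at h2
  push_cast at h1 h2
  exact ⟨by linarith, by linarith, evZ_nonneg_on_enclosure (by norm_num) cert_Sp_nonneg hx1 hx2,
    evZ_nonneg_on_enclosure (by norm_num) cert_Sm_nonneg hx1 hx2,
    evZ_nonneg_on_enclosure (by norm_num) cert_Um_nonneg hx1 hx2,
    evZ_nonneg_on_enclosure (by norm_num) cert_Rp_nonneg hx1 hx2⟩

/-! ## §15 The six forms from the box facts (pure real arithmetic) -/

/-- `4(ae - b²) ≥ 0` in the tail. [folklore] -/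
theorem form1 {Ap Bp Ep Am Bm Em : ℝ} (_hAp : 0 ≤ Ap) (_hAm : 0 ≤ Am) (_hBp : 0 ≤ Bp) (_hBm : 0 ≤ Bm) (_hEm : 0 ≤ Em)
    (_e1 : 13009 * Ap ≤ 10000 * Bp) (_e2 : 10000 * Bp ≤ 13799 * Ap) (_e3 : 13009 * Bp ≤ 10000 * Ep)
    (_o1 : 5041 * Am ≤ 10000 * Bm) (_o2 : 10000 * Bm ≤ 5677 * Am) (_o3 : 5041 * Bm ≤ 10000 * Em)
    (_o4 : 10000 * Em ≤ 5677 * Bm) (_hdet : 0 ≤ Ap * Ep - Bp * Bp) (_t1 : 100 * Bm ≤ 3 * Bp)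
    (_t2 : 4 * (Ap * Ep - Bp * Bp) ≤ Bp * Bm) :
    0 ≤ (Ap + Am) * (Ep + Em) - (Bp + Bm) * (Bp + Bm) := by
  nlinarith [mul_nonneg _hAm (by linarith : (0:ℝ) ≤ 10000 * Ep - 13009 * Bp),
    mul_nonneg _hBp (by linarith : (0:ℝ) ≤ 5677 * Am - 10000 * Bm), mul_nonneg _hBm (by linarith : (0:ℝ) ≤ 3 * Bp - 100 * Bm),
    mul_nonneg _hAp _hEm, mul_nonneg _hAm _hEm, mul_nonneg _hBp _hBm]


/-- `4(af - bc) ≥ 0` in the tail. [folklore] -/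
theorem form2 {Ap Bp Ep Am Bm Em : ℝ} (_hAp : 0 ≤ Ap) (_hAm : 0 ≤ Am) (_hBp : 0 ≤ Bp) (_hBm : 0 ≤ Bm) (_hEm : 0 ≤ Em)
    (_e1 : 13009 * Ap ≤ 10000 * Bp) (_e2 : 10000 * Bp ≤ 13799 * Ap) (_e3 : 13009 * Bp ≤ 10000 * Ep)
    (_o1 : 5041 * Am ≤ 10000 * Bm) (_o2 : 10000 * Bm ≤ 5677 * Am) (_o3 : 5041 * Bm ≤ 10000 * Em)
    (_o4 : 10000 * Em ≤ 5677 * Bm) (_hdet : 0 ≤ Ap * Ep - Bp * Bp) (_t1 : 100 * Bm ≤ 3 * Bp)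
    (_t2 : 4 * (Ap * Ep - Bp * Bp) ≤ Bp * Bm) :
    0 ≤ (Ap + Am) * (Ep - Em) - (Bp + Bm) * (Bp - Bm) := by
  nlinarith [mul_nonneg _hAm (by linarith : (0:ℝ) ≤ 10000 * Ep - 13009 * Bp),
    mul_nonneg _hBp (by linarith : (0:ℝ) ≤ 5677 * Am - 10000 * Bm), mul_nonneg _hEm (by linarith : (0:ℝ) ≤ 10000 * Bp - 13009 * Ap),
    mul_nonneg _hBp (by linarith : (0:ℝ) ≤ 5677 * Bm - 10000 * Em), mul_nonneg _hEm (by linarith : (0:ℝ) ≤ 10000 * Bm - 5041 * Am),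
    mul_nonneg _hBm (by linarith : (0:ℝ) ≤ 5677 * Bm - 10000 * Em), mul_nonneg _hBm (by linarith : (0:ℝ) ≤ 3 * Bp - 100 * Bm),
    sq_nonneg Bm, mul_nonneg _hBp _hBm]


/-- `4(ac - bd) ≥ 0` in the tail. [folklore] -/
theorem form3 {Ap Bp Ep Am Bm Em : ℝ} (_hAp : 0 ≤ Ap) (_hAm : 0 ≤ Am) (_hBp : 0 ≤ Bp) (_hBm : 0 ≤ Bm) (_hEm : 0 ≤ Em)
    (_e1 : 13009 * Ap ≤ 10000 * Bp) (_e2 : 10000 * Bp ≤ 13799 * Ap) (_e3 : 13009 * Bp ≤ 10000 * Ep)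
    (_o1 : 5041 * Am ≤ 10000 * Bm) (_o2 : 10000 * Bm ≤ 5677 * Am) (_o3 : 5041 * Bm ≤ 10000 * Em)
    (_o4 : 10000 * Em ≤ 5677 * Bm) (_hdet : 0 ≤ Ap * Ep - Bp * Bp) (_t1 : 100 * Bm ≤ 3 * Bp)
    (_t2 : 4 * (Ap * Ep - Bp * Bp) ≤ Bp * Bm) :
    0 ≤ (Ap + Am) * (Bp - Bm) - (Bp + Bm) * (Ap - Am) := by
  nlinarith [mul_nonneg _hAm (by linarith : (0:ℝ) ≤ 10000 * Bp - 13009 * Ap),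
    mul_nonneg _hAp (by linarith : (0:ℝ) ≤ 5677 * Am - 10000 * Bm), mul_nonneg _hAp _hBm]


/-- `4(bf - ce) ≥ 0` in the tail. [folklore] -/
theorem form4 {Ap Bp Ep Am Bm Em : ℝ} (_hAp : 0 ≤ Ap) (_hAm : 0 ≤ Am) (_hBp : 0 ≤ Bp) (_hBm : 0 ≤ Bm) (_hEm : 0 ≤ Em)
    (_e1 : 13009 * Ap ≤ 10000 * Bp) (_e2 : 10000 * Bp ≤ 13799 * Ap) (_e3 : 13009 * Bp ≤ 10000 * Ep)
    (_o1 : 5041 * Am ≤ 10000 * Bm) (_o2 : 10000 * Bm ≤ 5677 * Am) (_o3 : 5041 * Bm ≤ 10000 * Em)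
    (_o4 : 10000 * Em ≤ 5677 * Bm) (_hdet : 0 ≤ Ap * Ep - Bp * Bp) (_t1 : 100 * Bm ≤ 3 * Bp)
    (_t2 : 4 * (Ap * Ep - Bp * Bp) ≤ Bp * Bm) :
    0 ≤ (Bp + Bm) * (Ep - Em) - (Bp - Bm) * (Ep + Em) := by
  nlinarith [mul_nonneg _hBm (by linarith : (0:ℝ) ≤ 10000 * Ep - 13009 * Bp),
    mul_nonneg _hBp (by linarith : (0:ℝ) ≤ 5677 * Bm - 10000 * Em), mul_nonneg _hBp _hBm]


/-- `4(bc - de) ≥ 0` in the tail. [folklore] -/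
theorem form5 {Ap Bp Ep Am Bm Em : ℝ} (_hAp : 0 ≤ Ap) (_hAm : 0 ≤ Am) (_hBp : 0 ≤ Bp) (_hBm : 0 ≤ Bm) (_hEm : 0 ≤ Em)
    (_e1 : 13009 * Ap ≤ 10000 * Bp) (_e2 : 10000 * Bp ≤ 13799 * Ap) (_e3 : 13009 * Bp ≤ 10000 * Ep)
    (_o1 : 5041 * Am ≤ 10000 * Bm) (_o2 : 10000 * Bm ≤ 5677 * Am) (_o3 : 5041 * Bm ≤ 10000 * Em)
    (_o4 : 10000 * Em ≤ 5677 * Bm) (_hdet : 0 ≤ Ap * Ep - Bp * Bp) (_t1 : 100 * Bm ≤ 3 * Bp)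
    (_t2 : 4 * (Ap * Ep - Bp * Bp) ≤ Bp * Bm) :
    0 ≤ (Bp + Bm) * (Bp - Bm) - (Ap - Am) * (Ep + Em) := by
  nlinarith [mul_nonneg _hAm (by linarith : (0:ℝ) ≤ 10000 * Ep - 13009 * Bp),
    mul_nonneg _hBp (by linarith : (0:ℝ) ≤ 5677 * Am - 10000 * Bm), mul_nonneg _hEm (by linarith : (0:ℝ) ≤ 10000 * Bp - 13009 * Ap),
    mul_nonneg _hBp (by linarith : (0:ℝ) ≤ 5677 * Bm - 10000 * Em), mul_nonneg _hBm (by linarith : (0:ℝ) ≤ 3 * Bp - 100 * Bm),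
    mul_nonneg _hAm _hEm, mul_nonneg _hBp _hBm]


/-- `4(c² - df) ≥ 0` in the tail. [folklore] -/
theorem form6 {Ap Bp Ep Am Bm Em : ℝ} (_hAp : 0 ≤ Ap) (_hAm : 0 ≤ Am) (_hBp : 0 ≤ Bp) (_hBm : 0 ≤ Bm) (_hEm : 0 ≤ Em)
    (_e1 : 13009 * Ap ≤ 10000 * Bp) (_e2 : 10000 * Bp ≤ 13799 * Ap) (_e3 : 13009 * Bp ≤ 10000 * Ep)
    (_o1 : 5041 * Am ≤ 10000 * Bm) (_o2 : 10000 * Bm ≤ 5677 * Am) (_o3 : 5041 * Bm ≤ 10000 * Em)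
    (_o4 : 10000 * Em ≤ 5677 * Bm) (_hdet : 0 ≤ Ap * Ep - Bp * Bp) (_t1 : 100 * Bm ≤ 3 * Bp)
    (_t2 : 4 * (Ap * Ep - Bp * Bp) ≤ Bp * Bm) :
    0 ≤ (Bp - Bm) * (Bp - Bm) - (Ap - Am) * (Ep - Em) := by
  nlinarith [mul_nonneg _hEm (by linarith : (0:ℝ) ≤ 13799 * Ap - 10000 * Bp),
    mul_nonneg _hBp (by linarith : (0:ℝ) ≤ 10000 * Em - 5041 * Bm), mul_nonneg _hAm (by linarith : (0:ℝ) ≤ 10000 * Ep - 13009 * Bp),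
    mul_nonneg _hBp (by linarith : (0:ℝ) ≤ 5677 * Am - 10000 * Bm), mul_nonneg _hEm (by linarith : (0:ℝ) ≤ 10000 * Bm - 5041 * Am),
    mul_nonneg _hBm (by linarith : (0:ℝ) ≤ 5677 * Bm - 10000 * Em), mul_nonneg _hBm (by linarith : (0:ℝ) ≤ 3 * Bp - 100 * Bm),
    sq_nonneg Bm, mul_nonneg _hBp _hBm]



/-! ## §16 The six mixed forms for every length -/

/-- Semantics of the direct-check polynomials. [folklore] -/
theorem evZ_formPolys (n : ℕ) (x : ℝ) :
    let ue := evV (iterMV TeData 6 n ue0) x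
    let uo := evV (iterMV ToData 6 n uo0) x
    let we := evV (iterMV TeData 6 n we0) x
    let wo := evV (iterMV ToData 6 n wo0) x
    evZ ((formPolys n).getD 0 []) x = (ue 0 + uo 0) * (we 1 + wo 1) - (ue 1 + uo 1) * (ue 1 + uo 1) ∧
    evZ ((formPolys n).getD 1 []) x = (ue 0 + uo 0) * (we 1 - wo 1) - (ue 1 + uo 1) * (ue 1 - uo 1) ∧
    evZ ((formPolys n).getD 2 []) x = (ue 0 + uo 0) * (ue 1 - uo 1) - (ue 1 + uo 1) * (ue 0 - uo 0) ∧
    evZ ((formPolys n).getD 3 []) x = (ue 1 + uo 1) * (we 1 - wo 1) - (ue 1 - uo 1) * (we 1 + wo 1) ∧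
    evZ ((formPolys n).getD 4 []) x = (ue 1 + uo 1) * (ue 1 - uo 1) - (ue 0 - uo 0) * (we 1 + wo 1) ∧
    evZ ((formPolys n).getD 5 []) x = (ue 1 - uo 1) * (ue 1 - uo 1) - (ue 0 - uo 0) * (we 1 - wo 1) := by
  simp only [formPolys, evV, List.getD_cons_zero, List.getD_cons_succ, evZ_addZ, evZ_mulZ, evZ_smulZ]
  push_cast
  refine ⟨?_, ?_, ?_, ?_, ?_, ?_⟩ <;> ring

set_option maxHeartbeats 800000 in
/-- **The six mixed TP₂ forms of the width-4 strips, for every length `n` and every `x ∈ [1/3, 5/13]`**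
(abstract over the data-driven sector trajectories; see the file header). [folklore] -/
theorem strip4_mixedForms {x : ℝ} (hx1 : 1 / 3 ≤ x) (hx2 : x ≤ 5 / 13) (Up Wp Uo Wo : ℕ → ℕ → ℝ)
    (hUp0 : ∀ i, i < 6 → Up 0 i = evV ue0 x i) (hUp : ∀ t i, i < 6 → Up (t + 1) i = mulTV TeData 6 x (Up t) i)
    (hWp0 : ∀ i, i < 6 → Wp 0 i = evV we0 x i) (hWp : ∀ t i, i < 6 → Wp (t + 1) i = mulTV TeData 6 x (Wp t) i)
    (hUo0 : ∀ i, i < 6 → Uo 0 i = evV uo0 x i) (hUo : ∀ t i, i < 6 → Uo (t + 1) i = mulTV ToData 6 x (Uo t) i)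
    (hWo0 : ∀ i, i < 6 → Wo 0 i = evV wo0 x i) (hWo : ∀ t i, i < 6 → Wo (t + 1) i = mulTV ToData 6 x (Wo t) i)
    (hsymP : ∀ n, Wp n 0 = Up n 1) (hsymM : ∀ n, Wo n 0 = Uo n 1) (n : ℕ) :
    0 ≤ (Up n 0 + Uo n 0) * (Wp n 1 + Wo n 1) - (Up n 1 + Uo n 1) * (Up n 1 + Uo n 1) ∧
    0 ≤ (Up n 0 + Uo n 0) * (Wp n 1 - Wo n 1) - (Up n 1 + Uo n 1) * (Up n 1 - Uo n 1) ∧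
    0 ≤ (Up n 0 + Uo n 0) * (Up n 1 - Uo n 1) - (Up n 1 + Uo n 1) * (Up n 0 - Uo n 0) ∧
    0 ≤ (Up n 1 + Uo n 1) * (Wp n 1 - Wo n 1) - (Up n 1 - Uo n 1) * (Wp n 1 + Wo n 1) ∧
    0 ≤ (Up n 1 + Uo n 1) * (Up n 1 - Uo n 1) - (Up n 0 - Uo n 0) * (Wp n 1 + Wo n 1) ∧
    0 ≤ (Up n 1 - Uo n 1) * (Up n 1 - Uo n 1) - (Up n 0 - Uo n 0) * (Wp n 1 - Wo n 1) := by
  rcases Nat.lt_or_ge n 7 with hn | hn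
  · -- HEAD: direct kernel checks
    have hU := traj_eq_evV_iterMV TeData 6 x ue0 hUp0 hUp n
    have hW := traj_eq_evV_iterMV TeData 6 x we0 hWp0 hWp n
    have hUo' := traj_eq_evV_iterMV ToData 6 x uo0 hUo0 hUo n
    have hWo' := traj_eq_evV_iterMV ToData 6 x wo0 hWo0 hWo n
    obtain ⟨f0, f1, f2, f3, f4, f5⟩ := evZ_formPolys n x
    have c := fun j (hj : j < 6) => evZ_nonneg_on_enclosure (by norm_num) (cert_direct n hn j hj) hx1 hx2
    have c0 := c 0 (by norm_num); have c1 := c 1 (by norm_num); have c2 := c 2 (by norm_num)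
    have c3 := c 3 (by norm_num); have c4 := c 4 (by norm_num); have c5 := c 5 (by norm_num)
    rw [f0] at c0; rw [f1] at c1; rw [f2] at c2; rw [f3] at c3; rw [f4] at c4; rw [f5] at c5
    rw [hU 0 (by norm_num), hU 1 (by norm_num), hW 1 (by norm_num), hUo' 0 (by norm_num), hUo' 1 (by norm_num),
      hWo' 1 (by norm_num)]
    exact ⟨c0, c1, c2, c3, c4, c5⟩
  · -- TAIL: boxes, rates, and the two propagated comparisons
    have bU := even_tail_box hx1 hx2 cert_even_base_u hUp0 hUp
    have bW := even_tail_box hx1 hx2 cert_even_base_w hWp0 hWp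
    have bUo := odd_tail_box hx1 hx2 cert_odd_base_u hUo0 hUo
    have bWo := odd_tail_box hx1 hx2 cert_odd_base_w hWo0 hWo
    have bL2 := L2_tail_box hx1 hx2 hUp0 hWp0 hUp hWp
    obtain ⟨rSp, rSm, rUm, rRp⟩ := rates hx1 hx2
    obtain ⟨cUS, cRSS, Sp0, Sm0, Um0, Rp0⟩ := polyFacts hx1 hx2
    -- unpacking a box (coordinate 1) : `L₁ z0 ≤ 10⁴ z1 ≤ H₁ z0`, and the anchor sign
    have boxE : ∀ z : ℕ → ℝ, InBox EBL EBH 10000 6 z → 0 ≤ z 0 ∧ 13009 * z 0 ≤ 10000 * z 1 ∧ 10000 * z 1 ≤ 13799 * z 0 := by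
      intro z hz; have h := hz.2 1 (by norm_num); simp [EBL, EBH] at h; exact ⟨hz.1, by linarith [h.1], by linarith [h.2]⟩
    have boxO : ∀ z : ℕ → ℝ, InBox OBL OBH 10000 6 z → 0 ≤ z 0 ∧ 5041 * z 0 ≤ 10000 * z 1 ∧ 10000 * z 1 ≤ 5677 * z 0 := by
      intro z hz; have h := hz.2 1 (by norm_num); simp [OBL, OBH] at h; exact ⟨hz.1, by linarith [h.1], by linarith [h.2]⟩
    -- the anchor of the second compound is `det⁺ = U0 W1 - U1 W0`
    have det_eq : ∀ t, wedgeR 6 (Up t) (Wp t) 0 = Up t 0 * Wp t 1 - Up t 1 * Wp t 0 := by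
      intro t; simp only [wedgeR]; rw [pairs6_head]
    -- T1: 100 B⁻ ≤ 3 B⁺ from 7 on
    have T1 : ∀ t, 7 ≤ t → 100 * Uo t 1 ≤ 3 * Up t 1 := by
      intro t ht
      induction t, ht using Nat.le_induction with
      | base =>
        have h := evZ_nonneg_on_enclosure (by norm_num) cert_base_kappa hx1 hx2
        rw [evZ_addZ, evZ_smulZ, evZ_smulZ] at h
        push_cast at h
        have e1 := traj_eq_evV_iterMV TeData 6 x ue0 hUp0 hUp 7 1 (by norm_num)
        have e2 := traj_eq_evV_iterMV ToData 6 x uo0 hUo0 hUo 7 1 (by norm_num)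
        simp only [evV] at e1 e2
        rw [e1, e2]; linarith
      | succ t ht ih =>
        obtain ⟨hUo0', hUo1, -⟩ := boxO _ (bUo t ht)
        have hm0 : 0 ≤ Uo t 1 := by nlinarith
        have r1 := rUm _ (bUo t ht)      -- 10⁴ Uo' ≤ Um Uo
        have r2 := rSp _ (bU t ht)       -- Sp Up ≤ 10⁴ Up'
        rw [← hUo t 1 (by norm_num)] at r1
        rw [← hUp t 1 (by norm_num)] at r2
        have h3 : evZ Um x * Uo t 1 ≤ evZ Sp x * Uo t 1 := mul_le_mul_of_nonneg_right cUS hm0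
        have h4 : evZ Sp x * (100 * Uo t 1) ≤ evZ Sp x * (3 * Up t 1) := mul_le_mul_of_nonneg_left ih Sp0
        nlinarith
    -- T2: 4 det⁺ ≤ B⁺ B⁻ from 7 on
    have T2 : ∀ t, 7 ≤ t → 4 * wedgeR 6 (Up t) (Wp t) 0 ≤ Up t 1 * Uo t 1 := by
      intro t ht
      induction t, ht using Nat.le_induction with
      | base =>
        have h := evZ_nonneg_on_enclosure (by norm_num) cert_base_theta hx1 hx2
        rw [evZ_addZ, evZ_mulZ, evZ_smulZ] at h
        push_cast at h
        have e1 := traj_eq_evV_iterMV TeData 6 x ue0 hUp0 hUp 7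
        have e2 := traj_eq_evV_iterMV ToData 6 x uo0 hUo0 hUo 7 1 (by norm_num)
        have e3 := traj_eq_evV_iterMV TeData 6 x we0 hWp0 hWp 7
        have hw : wedgeR 6 (Up 7) (Wp 7) 0 = evV (wedgeV 6 (iterMV TeData 6 7 ue0) (iterMV TeData 6 7 we0)) x 0 := by
          rw [evV_wedgeV 6 _ _ x (by rw [pairs6_length]; norm_num)]
          exact wedgeR_congr 6 e1 e3 0
        simp only [evV] at e1 e2 hw
        rw [hw, e1 1 (by norm_num), e2]; linarith
      | succ t ht ih =>
        have hL := bL2 t ht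
        have hdet0 : 0 ≤ wedgeR 6 (Up t) (Wp t) 0 := hL.1
        obtain ⟨-, hUo1, -⟩ := boxO _ (bUo t ht)
        obtain ⟨-, hUp1, -⟩ := boxE _ (bU t ht)
        have hm0 : 0 ≤ Uo t 1 := by nlinarith [(boxO _ (bUo t ht)).1]
        have hp0 : 0 ≤ Up t 1 := by nlinarith [(boxE _ (bU t ht)).1]
        have r1 := rRp _ hL               -- 10⁴ det' ≤ Rp det
        have r2 := rSp _ (bU t ht)        -- Sp Up1 ≤ 10⁴ Up1'
        have r3 := rSm _ (bUo t ht)       -- Sm Uo1 ≤ 10⁴ Uo1'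
        have hrec' := (wedge_traj TeData 6 x hUp hWp t 0 (by rw [pairs6_length]; norm_num))
        rw [pairs6_length] at hrec'
        rw [← hrec'] at r1
        rw [← hUp t 1 (by norm_num)] at r2
        rw [← hUo t 1 (by norm_num)] at r3
        -- chain: 10⁸ · 4 det' ≤ 10⁴ · 4 Rp det ≤ 10⁴ Rp Up1 Uo1 ≤ Sp Sm Up1 Uo1 ≤ (10⁴ Up1')(10⁴ Uo1')
        have h1 : 10000 * (4 * wedgeR 6 (Up (t + 1)) (Wp (t + 1)) 0) ≤ 4 * (evZ Rp x * wedgeR 6 (Up t) (Wp t) 0) := by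
          linarith
        have h2 : evZ Rp x * (4 * wedgeR 6 (Up t) (Wp t) 0) ≤ evZ Rp x * (Up t 1 * Uo t 1) :=
          mul_le_mul_of_nonneg_left ih Rp0
        have h3 : 10000 * evZ Rp x * (Up t 1 * Uo t 1) ≤ evZ Sp x * evZ Sm x * (Up t 1 * Uo t 1) :=
          mul_le_mul_of_nonneg_right cRSS (mul_nonneg hp0 hm0)
        have h4 : evZ Sp x * Up t 1 * (evZ Sm x * Uo t 1) ≤ 10000 * Up (t + 1) 1 * (10000 * Uo (t + 1) 1) :=
          mul_le_mul r2 r3 (mul_nonneg Sm0 hm0) (by nlinarith)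
        nlinarith
    -- the facts at `n`
    obtain ⟨hAp, hBp1, hBp2⟩ := boxE _ (bU n hn)
    obtain ⟨hBq, hEp1, -⟩ := boxE _ (bW n hn)
    obtain ⟨hAm, hBm1, hBm2⟩ := boxO _ (bUo n hn)
    obtain ⟨hBr, hEm1, hEm2⟩ := boxO _ (bWo n hn)
    have hdet : 0 ≤ Up n 0 * Wp n 1 - Up n 1 * Wp n 0 := by rw [← det_eq]; exact (bL2 n hn).1
    have t1 := T1 n hn
    have t2 := T2 n hn
    rw [det_eq] at t2
    rw [hsymP n] at hBq hEp1 hdet t2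
    rw [hsymM n] at hBr hEm1 hEm2
    have hEm : 0 ≤ Wo n 1 := by linarith
    exact ⟨form1 hAp hAm hBq hBr hEm hBp1 hBp2 hEp1 hBm1 hBm2 hEm1 hEm2 hdet t1 t2,
      form2 hAp hAm hBq hBr hEm hBp1 hBp2 hEp1 hBm1 hBm2 hEm1 hEm2 hdet t1 t2,
      form3 hAp hAm hBq hBr hEm hBp1 hBp2 hEp1 hBm1 hBm2 hEm1 hEm2 hdet t1 t2,
      form4 hAp hAm hBq hBr hEm hBp1 hBp2 hEp1 hBm1 hBm2 hEm1 hEm2 hdet t1 t2,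
      form5 hAp hAm hBq hBr hEm hBp1 hBp2 hEp1 hBm1 hBm2 hEm1 hEm2 hdet t1 t2,
      form6 hAp hAm hBq hBr hEm hBp1 hBp2 hEp1 hBm1 hBm2 hEm1 hEm2 hdet t1 t2⟩

end Summit.CriticalPhenomena.SAWScalingLimit.Theorems.BoundaryTP2.StripCert
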